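import Mathlib
import Summits.PneNP.PneNP.Theorems.SignRepCertificate
import Summits.PneNP.PneNP.Theorems.SignDegCertBridge
import Summits.PneNP.PneNP.Theorems.Nc03AvoidResidualCoreCandCutNormCertificate

/-!
# The certificate LEG SYSTEM of a degree-≤2 sign-representation certificate, and the engine interface
# `sigCertified_of_legBound` (cell pnp-ideate, ROUND-18 item K1'' `SignDeg2Signing.SignDeg2SigningFP`, stage S1)

FRONTIER (range avoidance for `k`-local maps with sign-degree-≤2 tables, at linear stretch); a restricted-model
algorithmic rung; nothing here bears on P vs NP.

For a `k`-local map `I` and a certificate `c : SignRepCertificate.Cert I` (per output `j`: constant `c0 j`,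
linear `c1 j i`, pair `c2 j i i'` coefficients and a margin `τ`), the signing target of K1'' is
`bias + Σ_v |load_v| + max_X pairForm(X) < τ·m` for `Y = χ ∘ y` (`SignDeg2Signing.SigCertified`, whose
defining body is the conclusion of `sigCertified_of_legBound` below — this file imports no `Theses` module).
The line «sfm-bl» engine (`SfmBl*`, landed for pure CAND) bounds UNSIGNED bilinear LEG functionals
`Σ_e χ(y_{out e})·σ′(src e)·φ′(dst e)` over ALL `±1` vectors `σ′, φ′` on abstract PIECES (free splitting).
This file fixes the dictionary between the two:

* `CLeg c` — the certificate legs: one UNIT leg per (output `j`, kind `κ`, replica `r < |coef|`), kinds =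
  bias / linear slot `i` / ordered slot pair `(i,i')`; so integer coefficients become replicated unit legs and
  `#{legs of j} = |c0 j| + Σ_i |c1 j i| + Σ_{i,i'} |c2 j i i'|` (`card_legs_out`), which for the certificates
  built by `SignDegCertBridge.certOfIntCert` from weight-`W` data is `≤ 2W` (`card_legs_out_le_of_intCert`).
* `srcOwner` / `dstOwner` — the OWNER of a leg's two ends: a vertex (or the constant vertex `none`) together
  with one bit.  On the source side the bit is the ROLE (linear legs are evaluated at the sign of the load of
  their vertex, pair and bias legs at the assignment `X`); on the target side the bit is the SIGN of the
  coefficient.  Hence NO SIGNED LEGS and NO separate bias term are needed downstream: after free splitting every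
  piece carries an independent sign anyway, so a negative coefficient is a leg into the «negative twin» piece and
  the bias is a leg from the constant source piece to a constant target piece.
* `legSum_eq` — at the coupled assignment (`sigmaOf`, `phiOf`) the leg functional EQUALS
  `bias + Σ_v |load_v| + pairForm X`.
* `sigCertified_of_legBound` — THE INTERFACE: for ANY piece structure compatible with the owners, a uniform
  real bound `B` on the leg functional over all `±1` piece vectors with `B < τ·m` yields the signing certificate
  (`∃ e, (∀ X, pairForm X ≤ e) ∧ bias + Σ_v |load_v| + e < τ·m`, literally the body of `SigCertified I c y`).

Stage S2 (the engine made parametric in legs-per-output `ℓ` and target ratio) delivers exactly the hypothesis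
`hB`; stage S3 is the FP typing.  Elementary bookkeeping; no probability here.
-/

set_option linter.dupNamespace false -- `Summit.PneNP.PneNP.…`: summit = sub-problem name (D-0017 single-conjunct layout)

namespace Summit.PneNP.PneNP.Theorems.SignDeg2Legs

open Finset BigOperators Literature.Computability.Complexity SignRepCertificate
open Summit.PneNP.PneNP.Theorems.CandCutNorm (boolSign)

variable {k n m : ℕ}

/-! ### Legs -/

/-- The leg KINDS of one output of a `k`-local map: the bias (`inl ()`), a linear slot `i`
(`inr (inl i)`), an ordered slot pair `(i, i')` (`inr (inr (i, i'))`). -/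
abbrev Kind (k : ℕ) : Type := Unit ⊕ (Fin k ⊕ (Fin k × Fin k))

/-- The certificate coefficient carried by a kind at output `j`. -/
def coef {I : LocalMap k n m} (c : Cert I) (j : Fin m) : Kind k → ℤ
  | Sum.inl _ => c.c0 j
  | Sum.inr (Sum.inl i) => c.c1 j i
  | Sum.inr (Sum.inr p) => c.c2 j p.1 p.2

/-- The CERTIFICATE LEGS of `c`: triples (output `j`, kind `κ`, replica `r`) with `r < |coef c j κ|` — every
integer coefficient is split into `|coef|` unit legs. A finite type with decidable equality. -/
abbrev CLeg {I : LocalMap k n m} (c : Cert I) : Type :=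
  Σ j : Fin m, Σ κ : Kind k, Fin (coef c j κ).natAbs

/-- The output a leg belongs to (all legs of one output share the sign `χ(y_j)`). -/
abbrev CLeg.out {I : LocalMap k n m} {c : Cert I} (e : CLeg c) : Fin m := e.1

/-- The kind of a leg. -/
abbrev CLeg.kind {I : LocalMap k n m} {c : Cert I} (e : CLeg c) : Kind k := e.2.1

/-- OWNER OF THE SOURCE END of a leg: `(vertex?, role)`.  Bias legs: the constant source `none`; linear legs
of slot `i`: the vertex `I.vars j i` with role bit `true` («evaluate at the load sign»); pair legs `(i,i')`:
the vertex `I.vars j i` with role bit `false` («evaluate at `X`»). -/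
def srcOwner (I : LocalMap k n m) (j : Fin m) : Kind k → Option (Fin n) × Bool
  | Sum.inl _ => (none, false)
  | Sum.inr (Sum.inl i) => (some (I.vars j i), true)
  | Sum.inr (Sum.inr p) => (some (I.vars j p.1), false)

/-- The vertex at the TARGET END of a leg (`none` = the constant vertex, for bias and linear legs). -/
def dstVert (I : LocalMap k n m) (j : Fin m) : Kind k → Option (Fin n)
  | Sum.inl _ => none
  | Sum.inr (Sum.inl _) => none
  | Sum.inr (Sum.inr p) => some (I.vars j p.2)

/-- OWNER OF THE TARGET END of a leg: `(vertex?, sign bit)` with sign bit `true` iff the coefficient is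
negative (the leg then ends on the «negative twin» piece of its vertex). -/
def dstOwner (I : LocalMap k n m) (c : Cert I) (j : Fin m) (κ : Kind k) : Option (Fin n) × Bool :=
  (dstVert I j κ, decide (coef c j κ < 0))

/-! ### Counting legs -/

/-- The number of legs of output `j` is `Σ_κ |coef c j κ| = |c0 j| + Σ_i |c1 j i| + Σ_i Σ_i' |c2 j i i'|`. -/
theorem card_legs_out {I : LocalMap k n m} (c : Cert I) (j : Fin m) :
    ((Finset.univ.filter fun e : CLeg c => e.out = j).card : ℤ)
      = |c.c0 j| + ∑ i, |c.c1 j i| + ∑ i, ∑ i', |c.c2 j i i'| := by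
  classical
  -- the legs of output `j` are the fibre `{j} × Σ κ, Fin |coef|`
  have h1 : (Finset.univ.filter fun e : CLeg c => e.out = j).card = ∑ κ : Kind k, (coef c j κ).natAbs := by
    rw [Finset.card_filter, Fintype.sum_sigma]
    simp only [CLeg.out]
    have inner : ∀ j' : Fin m, (∑ p : (Σ κ : Kind k, Fin (coef c j' κ).natAbs), if j' = j then 1 else 0)
        = if j' = j then ∑ κ : Kind k, (coef c j' κ).natAbs else 0 := by
      intro j'
      split_ifs with h
      · rw [Fintype.sum_sigma]
        simp
      · simp
    rw [Finset.sum_congr rfl fun j' _ => inner j', Finset.sum_ite_eq' Finset.univ j, if_pos (Finset.mem_univ _)]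
  rw [h1]
  push_cast
  rw [Fintype.sum_sum_type, Fintype.sum_sum_type, Fintype.sum_prod_type]
  simp only [Finset.univ_unique, Finset.sum_singleton, coef]
  ring

/-- For the certificate assembled by `SignDegCertBridge.certOfIntCert` from integer sign-degree-≤`d` data of
weight `≤ W` (`d ≤ 2`; rows doubled, pair coefficients `cz {i,i'}` on ordered off-diagonal pairs), every output
owns at most `2W` legs: `|2 cz ∅| + Σ_i |2 cz {i}| + Σ_{i ≠ i'} |cz {i,i'}| = 2·Σ_{|S| ≤ 2} |cz S| ≤ 2W`. -/
theorem card_legs_out_le_of_intCert (I : LocalMap k n m) {d : ℕ} (hd : d ≤ 2) {W : ℤ}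
    (cI : ∀ j, SignDegIntCert.IntCert d W (I.table j)) (j : Fin m) :
    ((Finset.univ.filter fun e : CLeg (SignDegCertBridge.certOfIntCert I hd cI) => e.out = j).card : ℤ)
      ≤ 2 * W := by
  classical
  rw [card_legs_out]
  have hf : ∀ S : Finset (Fin k), 2 < S.card → |(cI j).cz S| = 0 := fun S hS => by
    rw [(cI j).high S (lt_of_le_of_lt hd hS), abs_zero]
  have hsplit := SignDegCertBridge.two_mul_sum_prod_eq (R := ℤ) (fun S => |(cI j).cz S|) hf (fun _ => 1)
  simp only [Finset.prod_const_one, mul_one] at hsplit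
  have hc0 : |(SignDegCertBridge.certOfIntCert I hd cI).c0 j| = 2 * |(cI j).cz ∅| := by
    simp [SignDegCertBridge.certOfIntCert, abs_mul]
  have hc1 : ∀ i, |(SignDegCertBridge.certOfIntCert I hd cI).c1 j i| = 2 * |(cI j).cz {i}| := fun i => by
    simp [SignDegCertBridge.certOfIntCert, abs_mul]
  have hc2 : ∀ i i', |(SignDegCertBridge.certOfIntCert I hd cI).c2 j i i'|
      = (if i = i' then 0 else |(cI j).cz {i, i'}|) := fun i i' => by
    simp only [SignDegCertBridge.certOfIntCert]
    split_ifs <;> simp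
  simp only [hc0, hc1, hc2]
  rw [← Finset.mul_sum]
  calc 2 * |(cI j).cz ∅| + 2 * ∑ i, |(cI j).cz {i}| + ∑ i, ∑ i', (if i = i' then 0 else |(cI j).cz {i, i'}|)
      = 2 * ∑ S, |(cI j).cz S| := hsplit.symm
    _ ≤ 2 * W := by linarith [(cI j).weight]

/-! ### The coupled assignment and the leg functional -/

/-- `X` extended by `1` at the constant vertex. -/
def optX (X : Fin n → ℤ) : Option (Fin n) → ℤ
  | none => 1
  | some v => X v

/-- The sign of the load of a vertex (`+1` at the constant vertex and at load `0`). -/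
def loadSign (I : LocalMap k n m) (c : Cert I) (Y : Fin m → ℤ) : Option (Fin n) → ℤ
  | none => 1
  | some v => if 0 ≤ load I c Y v then 1 else -1

/-- SOURCE-SIDE coupled assignment of an owner `(vertex?, role)`: the load sign for linear-role owners,
`X` (or `1`) otherwise. -/
def sigmaOf (I : LocalMap k n m) (c : Cert I) (Y : Fin m → ℤ) (X : Fin n → ℤ) (o : Option (Fin n) × Bool) : ℤ :=
  if o.2 then loadSign I c Y o.1 else optX X o.1

/-- TARGET-SIDE coupled assignment of an owner `(vertex?, sign)`: `± X` (or `± 1`). -/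
def phiOf (X : Fin n → ℤ) (o : Option (Fin n) × Bool) : ℤ :=
  (if o.2 then -1 else 1) * optX X o.1

/-- `sigmaOf` takes values in `{1, −1}` on `±1` data. -/
theorem sigmaOf_cases (I : LocalMap k n m) (c : Cert I) (Y : Fin m → ℤ) (X : Fin n → ℤ)
    (hX : ∀ v, X v = 1 ∨ X v = -1) (o : Option (Fin n) × Bool) :
    sigmaOf I c Y X o = 1 ∨ sigmaOf I c Y X o = -1 := by
  obtain ⟨v, b⟩ := o
  cases b
  · cases v with
    | none => simp [sigmaOf, optX]
    | some v => simpa [sigmaOf, optX] using hX v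
  · cases v with
    | none => simp [sigmaOf, loadSign]
    | some v => by_cases h : 0 ≤ load I c Y v <;> simp [sigmaOf, loadSign, h]

/-- `phiOf` takes values in `{1, −1}` on `±1` data. -/
theorem phiOf_cases (X : Fin n → ℤ) (hX : ∀ v, X v = 1 ∨ X v = -1) (o : Option (Fin n) × Bool) :
    phiOf X o = 1 ∨ phiOf X o = -1 := by
  obtain ⟨v, b⟩ := o
  cases v with
  | none => cases b <;> simp [phiOf, optX]
  | some v => rcases hX v with h | h <;> cases b <;> simp [phiOf, optX, h]

/-- `|a|·(sign twin) = a`: `(|a| : ℤ) * (if a < 0 then -1 else 1) = a`. -/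
theorem natAbs_mul_signTwin (a : ℤ) : ((a.natAbs : ℕ) : ℤ) * (if a < 0 then -1 else 1) = a := by
  rw [Int.natCast_natAbs]
  split_ifs with h
  · rw [abs_of_neg h]; ring
  · rw [abs_of_nonneg (not_lt.1 h)]; ring

/-- The loads regrouped by vertex: `Σ_j Σ_i Y_j c1_{j,i} s(vars j i) = Σ_v s_v · load_v`. -/
theorem sum_linear_eq_sum_load (I : LocalMap k n m) (c : Cert I) (Y : Fin m → ℤ) (s : Fin n → ℤ) :
    ∑ j, ∑ i, Y j * c.c1 j i * s (I.vars j i) = ∑ v, s v * load I c Y v := by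
  classical
  have key : ∀ j i, Y j * c.c1 j i * s (I.vars j i)
      = ∑ v : Fin n, s v * (if I.vars j i = v then Y j * c.c1 j i else 0) := by
    intro j i
    rw [Finset.sum_eq_single (I.vars j i)]
    · simp only [if_true]; ring
    · intro v _ hv; rw [if_neg (Ne.symm hv), mul_zero]
    · intro h; exact absurd (Finset.mem_univ _) h
  have h1 : ∑ j, ∑ i, Y j * c.c1 j i * s (I.vars j i)
      = ∑ j : Fin m, ∑ i : Fin k, ∑ v : Fin n, s v * (if I.vars j i = v then Y j * c.c1 j i else 0) :=
    Finset.sum_congr rfl fun j _ => Finset.sum_congr rfl fun i _ => key j i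
  rw [h1]
  have h2 : ∑ j : Fin m, ∑ i : Fin k, ∑ v : Fin n, s v * (if I.vars j i = v then Y j * c.c1 j i else 0)
      = ∑ v : Fin n, ∑ j : Fin m, ∑ i : Fin k, s v * (if I.vars j i = v then Y j * c.c1 j i else 0) := by
    calc ∑ j : Fin m, ∑ i : Fin k, ∑ v : Fin n, s v * (if I.vars j i = v then Y j * c.c1 j i else 0)
        = ∑ j : Fin m, ∑ v : Fin n, ∑ i : Fin k, s v * (if I.vars j i = v then Y j * c.c1 j i else 0) :=
          Finset.sum_congr rfl fun j _ => Finset.sum_comm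
      _ = _ := Finset.sum_comm
  rw [h2]
  refine Finset.sum_congr rfl fun v _ => ?_
  simp only [load, Finset.mul_sum]

/-- `s_v · load_v = |load_v|` for the load sign. -/
theorem loadSign_mul_load (I : LocalMap k n m) (c : Cert I) (Y : Fin m → ℤ) (v : Fin n) :
    loadSign I c Y (some v) * load I c Y v = |load I c Y v| := by
  simp only [loadSign]
  split_ifs with h
  · rw [abs_of_nonneg h, one_mul]
  · rw [abs_of_neg (not_le.1 h)]; ring

/-- **THE DICTIONARY.**  At the coupled assignment the (unsigned, unit-leg) functional of the certificate leg
system equals `bias + Σ_v |load_v| + pairForm X`. -/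
theorem legSum_eq (I : LocalMap k n m) (c : Cert I) (Y : Fin m → ℤ) (X : Fin n → ℤ) :
    ∑ e : CLeg c, Y e.out * sigmaOf I c Y X (srcOwner I e.out e.kind) * phiOf X (dstOwner I c e.out e.kind)
      = bias I c Y + ∑ v, |load I c Y v| + pairForm I c Y X := by
  classical
  -- collapse the replicas: `Σ_{r < |coef|} t = |coef| · t`
  have h1 : ∑ e : CLeg c, Y e.out * sigmaOf I c Y X (srcOwner I e.out e.kind) * phiOf X (dstOwner I c e.out e.kind)
      = ∑ j, ∑ κ : Kind k, ((coef c j κ).natAbs : ℤ) *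
          (Y j * sigmaOf I c Y X (srcOwner I j κ) * phiOf X (dstOwner I c j κ)) := by
    simp only [CLeg.out, CLeg.kind]
    rw [Fintype.sum_sigma]
    refine Finset.sum_congr rfl fun j _ => ?_
    rw [Fintype.sum_sigma]
    refine Finset.sum_congr rfl fun κ _ => ?_
    simp only [Finset.sum_const, Finset.card_univ, Fintype.card_fin, nsmul_eq_mul]
  rw [h1]
  -- evaluate each kind: `|coef|·Y·σ·(±optX) = Y·coef·(value)`
  have h2 : ∀ j (κ : Kind k), ((coef c j κ).natAbs : ℤ) *
      (Y j * sigmaOf I c Y X (srcOwner I j κ) * phiOf X (dstOwner I c j κ))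
      = Y j * coef c j κ * (sigmaOf I c Y X (srcOwner I j κ) * optX X (dstVert I j κ)) := by
    intro j κ
    have := natAbs_mul_signTwin (coef c j κ)
    simp only [phiOf, dstOwner, decide_eq_true_eq]
    calc ((coef c j κ).natAbs : ℤ) * (Y j * sigmaOf I c Y X (srcOwner I j κ)
          * ((if coef c j κ < 0 then -1 else 1) * optX X (dstVert I j κ)))
        = (((coef c j κ).natAbs : ℤ) * (if coef c j κ < 0 then -1 else 1))
          * (Y j * (sigmaOf I c Y X (srcOwner I j κ) * optX X (dstVert I j κ))) := by ring
      _ = _ := by rw [this]; ring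
  simp only [h2]
  -- split the kinds
  simp only [Fintype.sum_sum_type, Fintype.sum_prod_type, Finset.univ_unique, Finset.sum_singleton]
  simp only [coef, srcOwner, dstVert, sigmaOf, optX, Bool.false_eq_true, if_false, if_true, mul_one]
  -- bias + linear + pair
  rw [Finset.sum_add_distrib, Finset.sum_add_distrib]
  have hb : ∑ j, Y j * c.c0 j = bias I c Y := by simp [bias]
  have hl : ∑ j, ∑ i, Y j * c.c1 j i * loadSign I c Y (some (I.vars j i)) = ∑ v, |load I c Y v| := by
    rw [sum_linear_eq_sum_load I c Y (fun v => loadSign I c Y (some v))]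
    exact Finset.sum_congr rfl fun v _ => loadSign_mul_load I c Y v
  have hp : ∑ j, ∑ i, ∑ i', Y j * c.c2 j i i' * (X (I.vars j i) * X (I.vars j i')) = pairForm I c Y X := by
    simp only [pairForm, Finset.mul_sum]
    exact Finset.sum_congr rfl fun j _ => Finset.sum_congr rfl fun i _ =>
      Finset.sum_congr rfl fun i' _ => by ring
  rw [hb, hl, hp]
  ring

/-! ### The interface theorem -/

/-- **`sigCertified_of_legBound` (K1'' stage S1, the engine interface).**  `I` a `k`-local map, `c` a
certificate, `y` a point, `Y_j = χ(y_j)`.  Take ANY piece structure for the certificate legs — maps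
`src : CLeg c → α`, `dst : CLeg c → β` into piece types with owner maps `own₁, own₂` satisfying the two
compatibilities `own₁ (src e) = srcOwner …`, `own₂ (dst e) = dstOwner …` (free splitting: any assignment of
legs to pieces of the right owner).  If the unsigned leg functional `Σ_e χ(y_{out e})·σ′(src e)·φ′(dst e)` is
`≤ B` for ALL real `±1` vectors `σ′, φ′` on the pieces and `B < τ·m`, then `y` is sign-certified for `c`:
`∃ e, (∀ X ∈ {±1}ⁿ, pairForm(Y, X) ≤ e) ∧ bias(Y) + Σ_v |load_v(Y)| + e < τ·m` — literally the body of
`SignDeg2Signing.SigCertified I c y` (so `y ∉ Range(I)` by `SignRepCertificate.not_mem_range_of_certificate`).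
Proof: at `σ′ = sigmaOf ∘ own₁`, `φ′ = phiOf ∘ own₂` the functional is `bias + Σ|load| + pairForm X`
(`legSum_eq`); take `e = ⌊B⌋ − bias − Σ|load|`. -/
theorem sigCertified_of_legBound (I : LocalMap k n m) (c : Cert I) (y : Fin m → Bool)
    {α β : Type*} (src : CLeg c → α) (dst : CLeg c → β)
    (own₁ : α → Option (Fin n) × Bool) (own₂ : β → Option (Fin n) × Bool)
    (hsrc : ∀ e : CLeg c, own₁ (src e) = srcOwner I e.out e.kind)
    (hdst : ∀ e : CLeg c, own₂ (dst e) = dstOwner I c e.out e.kind)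
    (B : ℝ)
    (hB : ∀ (σ' : α → ℝ) (φ' : β → ℝ), (∀ a, σ' a = 1 ∨ σ' a = -1) → (∀ b, φ' b = 1 ∨ φ' b = -1) →
      ∑ e : CLeg c, ((boolSign (y e.out) : ℤ) : ℝ) * σ' (src e) * φ' (dst e) ≤ B)
    (hBm : B < (c.τ : ℝ) * m) :
    ∃ e : ℤ, (∀ X : Fin n → ℤ, (∀ v, X v = 1 ∨ X v = -1) → pairForm I c (fun j => pm (y j)) X ≤ e) ∧
      bias I c (fun j => pm (y j)) + ∑ v, |load I c (fun j => pm (y j)) v| + e < c.τ * m := by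
  classical
  set Y : Fin m → ℤ := fun j => pm (y j) with hY
  have hχ : ∀ j, boolSign (y j) = Y j := fun j => rfl
  -- the functional at the coupled assignment, for each `X`
  have hval : ∀ X : Fin n → ℤ, (∀ v, X v = 1 ∨ X v = -1) →
      ((bias I c Y + ∑ v, |load I c Y v| + pairForm I c Y X : ℤ) : ℝ) ≤ B := by
    intro X hX
    have h := hB (fun a => (sigmaOf I c Y X (own₁ a) : ℝ)) (fun b => (phiOf X (own₂ b) : ℝ))
      (fun a => by rcases sigmaOf_cases I c Y X hX (own₁ a) with h | h <;> simp [h])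
      (fun b => by rcases phiOf_cases X hX (own₂ b) with h | h <;> simp [h])
    simp only [hsrc, hdst, hχ] at h
    rw [← legSum_eq I c Y X]
    push_cast
    exact h
  -- integer form via the floor of `B`
  have hfloor : ∀ X : Fin n → ℤ, (∀ v, X v = 1 ∨ X v = -1) →
      bias I c Y + ∑ v, |load I c Y v| + pairForm I c Y X ≤ ⌊B⌋ := fun X hX =>
    Int.le_floor.2 (hval X hX)
  refine ⟨⌊B⌋ - bias I c Y - ∑ v, |load I c Y v|, fun X hX => by linarith [hfloor X hX], ?_⟩
  have h1 : (⌊B⌋ : ℝ) < (c.τ : ℝ) * m := (Int.floor_le B).trans_lt hBm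
  have h2 : ⌊B⌋ < c.τ * m := by exact_mod_cast h1
  linarith

end Summit.PneNP.PneNP.Theorems.SignDeg2Legs
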